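import Literature.NumberTheory.Transcendental.KZHomotopyMoves
import Literature.NumberTheory.Transcendental.KZProductIdeal
import Literature.NumberTheory.Transcendental.KZCubicalCalculus

/-!
# Green's formula on the unit square with one rider coordinate, inside the Kontsevich–Zagier calculus

Support file for item `QuarterDiscFaceWeightTwo` (stmt-KontsevichZagierPeriods-9437, route
KontsevichZagierPeriods/OctahedralSymmetry): the ENGINE of the quarter-disc face, stated in general.

`green_rider`: on the closed unit cube `[0,1]³` let `F, G, H` be `ℚ`-semialgebraic and continuous,
and suppose that along the LAST coordinate `∂ₜ F(z, t) = H(z, t)` and `∂ₜ G(z, t) = H((z, t) ∘ e)`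
for a fixed permutation `e` of the three coordinates (`z ∈ [0,1]²`, `0 < t < 1`). Then the four face
representations `A₁ = [[0,1]², F(·,1)]`, `A₀ = [[0,1]², F(·,0)]`, `B₁ = [[0,1]², G(·,1)]`,
`B₀ = [[0,1]², G(·,0)]` exist and `([A₁] − [A₀]) − ([B₁] − [B₀]) ∈ KZ.relations`.

This is Green's theorem `∮ (f dx + g dy) = ∬ (∂ₓg − ∂_y f) = 0` for a closed `1`-form on the unit
square whose coefficients depend on one further "rider" coordinate (an inner integration variable),
written as a chain of Kontsevich–Zagier moves: rule (3) along the last coordinate on `[[0,1]³, H]`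
(`KZ.exists_homotopy_newtonLeibniz`), rule (2) for the coordinate permutation `e`
(`KZ.of_sub_of_reindex_mem_relations`), rule (3) again, and rule (1b). The primitives entering
rule (3) are the coefficient functions `F`, `G` themselves, never a transcendental integral.

References: M. Kontsevich, D. Zagier, *Periods* (2001), §1.2 rules (1)–(3) ("in several variables
replace the Newton–Leibniz formula by Stokes's formula").
Design: theorems only, no definitions; the faces are returned by an existence statement recording
their domains and integrands (the style of `KZHomotopyMoves.lean`).
-/

noncomputable section

open Set MeasureTheory
open Literature.NumberTheory.Transcendental Literature.NumberTheory.Transcendental.KZ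
open Literature.ModelTheory.ExponentialFields (IsSemialgebraic)

namespace Summit.KontsevichZagierPeriods.OctahedralSymmetry.QuarterDiscFace

/-! ## Cube bookkeeping -/

/-- The closed cube `[0,1]ⁿ⁺¹` is the unit band over `[0,1]ⁿ` along the last coordinate. [folklore] -/
theorem band_cube_eq (n : ℕ) :
    KZlog.band (cube n) (fun _ => (0 : ℝ)) (fun _ => 1) = cube (n + 1) := by
  rw [cube_succ_eq]; rfl

/-- A point `(z, t)` with `z ∈ [0,1]ⁿ`, `t ∈ [0,1]` lies in `[0,1]ⁿ⁺¹`. [folklore] -/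
theorem snoc_mem_cube {n : ℕ} {z : Fin n → ℝ} (hz : z ∈ cube n) {t : ℝ} (ht : t ∈ Icc (0 : ℝ) 1) :
    (Fin.snoc z t : Fin (n + 1) → ℝ) ∈ cube (n + 1) :=
  snoc_mem_cube_iff.2 ⟨hz, ht.1, ht.2⟩

/-- Restriction to a rational face `x ↦ (x, q)`, `q ∈ [0,1] ∩ ℚ`, of a function `ℚ`-semialgebraic
on the closed cube is `ℚ`-semialgebraic (composition with a polynomial map).
[cite: BochnakCosteRoy1998, Prop. 2.2.6] -/
theorem isSemialgebraicFunOn_face {n : ℕ} {F : (Fin (n + 1) → ℝ) → ℝ}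
    (hF : IsSemialgebraicFunOn ℚ (cube (n + 1)) F) (q : ℚ) (hq : (q : ℝ) ∈ Icc (0 : ℝ) 1) :
    IsSemialgebraicFunOn ℚ (cube n) (fun x => F (Fin.snoc x (q : ℝ))) := by
  have hP : IsSemialgebraicMapOn ℚ (cube n)
      (fun x : Fin n → ℝ => (Fin.snoc x (q : ℝ) : Fin (n + 1) → ℝ)) := by
    refine (isSemialgebraicMapOn_aeval isSemialgebraic_cube (fun j : Fin (n + 1) =>
      (Fin.snoc (α := fun _ : Fin (n + 1) => MvPolynomial (Fin n) ℚ)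
        (fun i : Fin n => MvPolynomial.X i) (MvPolynomial.C q) j))).congr fun x _ => ?_
    funext j
    refine Fin.lastCases ?_ (fun i => ?_) j
    · simp only [Fin.snoc_last, MvPolynomial.aeval_C, eq_ratCast]
    · simp only [Fin.snoc_castSucc, MvPolynomial.aeval_X]
  exact IsSemialgebraicFunOn.comp_isSemialgebraicMapOn_holds hF hP fun x hx => snoc_mem_cube hx hq

/-- Restriction to a face `x ↦ (x, c)`, `c ∈ [0,1]`, of a function continuous on the closed cube is
continuous on the closed cube one dimension down. [folklore] -/
theorem continuousOn_face {n : ℕ} {F : (Fin (n + 1) → ℝ) → ℝ} (hF : ContinuousOn F (cube (n + 1)))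
    {c : ℝ} (hc : c ∈ Icc (0 : ℝ) 1) : ContinuousOn (fun x => F (Fin.snoc x c)) (cube n) := by
  have hγ : Continuous fun x : Fin n → ℝ => (Fin.snoc x c : Fin (n + 1) → ℝ) :=
    Continuous.finSnoc continuous_id continuous_const
  exact hF.comp hγ.continuousOn fun _ hx => snoc_mem_cube hx hc

/-- The fibre `t ↦ F (z, t)` over `z ∈ [0,1]ⁿ` of a function continuous on the closed cube is
continuous on `[0,1]`. [folklore] -/
theorem continuousOn_fibre {n : ℕ} {F : (Fin (n + 1) → ℝ) → ℝ} (hF : ContinuousOn F (cube (n + 1)))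
    {z : Fin n → ℝ} (hz : z ∈ cube n) : ContinuousOn (fun t : ℝ => F (Fin.snoc z t)) (Icc 0 1) := by
  have hγ : Continuous fun t : ℝ => (Fin.snoc z t : Fin (n + 1) → ℝ) :=
    Continuous.finSnoc continuous_const continuous_id
  exact hF.comp hγ.continuousOn fun _ ht => snoc_mem_cube hz ht

/-- A function continuous on the closed cube, read in permuted coordinates, is continuous on the
closed cube. [folklore] -/
theorem continuousOn_comp_perm {m : ℕ} {H : (Fin m → ℝ) → ℝ} (hH : ContinuousOn H (cube m))
    (e : Equiv.Perm (Fin m)) : ContinuousOn (fun v : Fin m → ℝ => H (fun i => v (e i))) (cube m) := by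
  refine hH.comp (continuous_pi fun i => continuous_apply (e i)).continuousOn fun v hv => ?_
  exact fun j => hv (e j)

/-! ## The engine -/

/-- **Green's formula on the unit square with a rider, as Kontsevich–Zagier moves.** Let `F, G, H` be
`ℚ`-semialgebraic and continuous on `[0,1]³`, `e` a permutation of the three coordinates, and assume
the fibrewise derivatives along the last coordinate `∂ₜ F(z,t) = H(z,t)`, `∂ₜ G(z,t) = H((z,t) ∘ e)`
for `z ∈ [0,1]²`, `t ∈ (0,1)`. Then there are face representations `A₁, A₀, B₁, B₀` on `[0,1]²` with
integrands `F(·,1)`, `F(·,0)`, `G(·,1)`, `G(·,0)` and `([A₁] − [A₀]) − ([B₁] − [B₀]) ∈ KZ.relations`: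
rule (3) on `[[0,1]³, H]` along the last coordinate, the coordinate permutation `e` (rule (2),
`|det| = 1`), rule (3) on the permuted cube, rule (1b). [cite: KontsevichZagier2001, §1.2 rule (3)] -/
theorem green_rider (e : Equiv.Perm (Fin 3)) {F G H : (Fin 3 → ℝ) → ℝ}
    (hFs : IsSemialgebraicFunOn ℚ (cube 3) F) (hGs : IsSemialgebraicFunOn ℚ (cube 3) G)
    (hHs : IsSemialgebraicFunOn ℚ (cube 3) H)
    (hFc : ContinuousOn F (cube 3)) (hGc : ContinuousOn G (cube 3)) (hHc : ContinuousOn H (cube 3))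
    (hFd : ∀ z ∈ cube 2, ∀ t ∈ Ioo (0 : ℝ) 1,
      HasDerivAt (fun s : ℝ => F (Fin.snoc z s)) (H (Fin.snoc z t)) t)
    (hGd : ∀ z ∈ cube 2, ∀ t ∈ Ioo (0 : ℝ) 1,
      HasDerivAt (fun s : ℝ => G (Fin.snoc z s))
        (H (fun i => (Fin.snoc z t : Fin 3 → ℝ) (e i))) t) :
    ∃ A₁ A₀ B₁ B₀ : IntegralRep 2,
      A₁.domain = cube 2 ∧ (A₁.integrand = fun z => F (Fin.snoc z 1)) ∧
      A₀.domain = cube 2 ∧ (A₀.integrand = fun z => F (Fin.snoc z 0)) ∧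
      B₁.domain = cube 2 ∧ (B₁.integrand = fun z => G (Fin.snoc z 1)) ∧
      B₀.domain = cube 2 ∧ (B₀.integrand = fun z => G (Fin.snoc z 0)) ∧
      (of A₁ - of A₀) - (of B₁ - of B₀) ∈ relations := by
  have hband := band_cube_eq 2
  have h0 : (0 : ℝ) ∈ Icc (0 : ℝ) 1 := ⟨le_rfl, zero_le_one⟩
  have h1 : (1 : ℝ) ∈ Icc (0 : ℝ) 1 := ⟨zero_le_one, le_rfl⟩
  -- the permuted derivative
  set K : (Fin 3 → ℝ) → ℝ := fun v => H (fun i => v (e i)) with hK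
  have hperm : {w : Fin 3 → ℝ | (fun j => w (e j)) ∈ cube 3} = cube 3 := by
    ext w
    simp only [mem_setOf_eq, mem_cube]
    exact ⟨fun h j => by simpa using h (e.symm j), fun h j => h (e j)⟩
  have hKs : IsSemialgebraicFunOn ℚ (cube 3) K := by
    have h := hHs.comp_equiv e
    rwa [hperm] at h
  have hKc : ContinuousOn K (cube 3) := continuousOn_comp_perm hHc e
  -- faces
  have hF1s : IsSemialgebraicFunOn ℚ (cube 2) (fun z => F (Fin.snoc z 1)) := by
    simpa using isSemialgebraicFunOn_face hFs 1 (by norm_num)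
  have hF0s : IsSemialgebraicFunOn ℚ (cube 2) (fun z => F (Fin.snoc z 0)) := by
    simpa using isSemialgebraicFunOn_face hFs 0 (by norm_num)
  have hG1s : IsSemialgebraicFunOn ℚ (cube 2) (fun z => G (Fin.snoc z 1)) := by
    simpa using isSemialgebraicFunOn_face hGs 1 (by norm_num)
  have hG0s : IsSemialgebraicFunOn ℚ (cube 2) (fun z => G (Fin.snoc z 0)) := by
    simpa using isSemialgebraicFunOn_face hGs 0 (by norm_num)
  -- rule (3) along the last coordinate, twice
  obtain ⟨X, A₁, A₀, hXd, hXi, hA₁d, hA₁i, hA₀d, hA₀i, hX⟩ :=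
    exists_homotopy_newtonLeibniz (D := cube 2) isSemialgebraic_cube F H
      (hband ▸ hFs) (hband ▸ hHs) (fun z hz => continuousOn_fibre hFc hz) hFd
      (hband ▸ hHc.integrableOn_compact isCompact_cube) hF1s hF0s
      ((continuousOn_face hFc h1).integrableOn_compact isCompact_cube)
      ((continuousOn_face hFc h0).integrableOn_compact isCompact_cube)
  obtain ⟨Y, B₁, B₀, hYd, hYi, hB₁d, hB₁i, hB₀d, hB₀i, hY⟩ :=
    exists_homotopy_newtonLeibniz (D := cube 2) isSemialgebraic_cube G K
      (hband ▸ hGs) (hband ▸ hKs) (fun z hz => continuousOn_fibre hGc hz) hGd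
      (hband ▸ hKc.integrableOn_compact isCompact_cube) hG1s hG0s
      ((continuousOn_face hGc h1).integrableOn_compact isCompact_cube)
      ((continuousOn_face hGc h0).integrableOn_compact isCompact_cube)
  -- rule (2): the coordinate permutation
  have hXR := of_sub_of_reindex_mem_relations X e
  have hRY : of (X.reindex e) - of Y ∈ relations := by
    refine of_sub_of_mem_relations_of_eqOn ?_ fun w _ => ?_
    · rw [IntegralRep.reindex_domain, hXd, hYd, hband, hperm]
    · simp only [IntegralRep.reindex_integrand, hXi, hYi, hK]
  refine ⟨A₁, A₀, B₁, B₀, hA₁d, hA₁i, hA₀d, hA₀i, hB₁d, hB₁i, hB₀d, hB₀i, ?_⟩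
  have : (of A₁ - of A₀) - (of B₁ - of B₀) = -(of X - (of A₁ - of A₀)) + (of Y - (of B₁ - of B₀)) +
      (of X - of (X.reindex e)) + (of (X.reindex e) - of Y) := by abel
  rw [this]
  exact relations.add_mem (relations.add_mem (relations.add_mem (relations.neg_mem hX) hY) hXR) hRY

end Summit.KontsevichZagierPeriods.OctahedralSymmetry.QuarterDiscFace

end
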